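import Summits.ABC.ABC.Theorems.TameLocalReceptacle.Negative.TameLocalReceptacleQuadraticLocal

/-!
# Crux `TameLocalReceptacle` (stmt-ABC-14354): the KUMMER-LOCAL receptacle is false (unconditional)

The cleanest typed face of branch (i) of crux `ReceptacleIdentity` (lead `prover-line-stmt-ABC-14354-0`):
a table is KUMMER-LOCAL at modulus `ℓⁿ` when, at every odd prime `p`, its entry `t(p; i,j,k; r,s,z)` is
unchanged if a residue `r` is replaced by `r · u^{2ℓⁿ} (mod p)` for a unit `u` (and likewise for `s`,
`z`) — i.e. it reads each unit residue only through its class in `𝔽_p^× / (𝔽_p^×)^{2ℓⁿ}`, which is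
EXACTLY what the Kummer classes of `a, b, c, Δ, j` in `H¹(ℚ_p, μ_{ℓⁿ}) = ℚ_p^×/(ℚ_p^×)^{ℓⁿ}` (class mod
`ℓⁿ`-th powers) together with the quadratic twist of the Frey–Tate curve (class mod squares) can see
(`ℚ_p^× = p^ℤ × μ_{p−1} × (1 + pℤ_p)`, the last factor `ℓ`-divisible).  No side condition on `p` here.

`not_tameLocalReceptacle_kummerLocal`: the crux with the table additionally Kummer-local is FALSE.
Proof: at an odd prime `p` with `ℓ ∤ p − 1` the `ℓⁿ`-th power map is a bijection of `𝔽_p^×`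
(`units_pow_surjective`, Mathlib's `powCoprime`), so two residues with the same Legendre symbol differ
by a `2ℓⁿ`-th power of a unit (`exists_unit_pow_of_jacobiSym_eq`) and a Kummer-local table is
quadratic-local there; now apply `tameLocal_quadraticLocal_false` (whose certificate lives below `ℓ`).
-/

-- `Summit.<Summit>.<Problem>` is the mandated summit-side namespace (CONVENTIONS §2); for the
-- single-conjunct summit `ABC` the two coincide, so the duplicate `ABC.ABC` is deliberate.
set_option linter.dupNamespace false

namespace Summit.ABC.ABC.Theorems.TameLocalReceptacle

open NumberTheorySymbols Literature.NumberTheory.DiophantineGeometry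

/-- In `(ZMod p)ˣ` (`p` prime) with `gcd(p − 1, m) = 1` every unit is an `m`-th power (the `m`-th power
map is the bijection `powCoprime`). [folklore] -/
theorem units_pow_surjective {p : ℕ} [Fact p.Prime] {m : ℕ} (h : Nat.Coprime (p - 1) m) :
    Function.Surjective (fun u : (ZMod p)ˣ => u ^ m) := by
  have hc : (Nat.card (ZMod p)ˣ).Coprime m := by
    rwa [Nat.card_eq_fintype_card, ZMod.card_units]
  intro v
  exact ⟨(powCoprime hc).symm v, (powCoprime hc).apply_symm_apply v⟩

/-- `J(r | p) = 0 ↔ p ∣ r` for a prime `p` and `r : ℕ`. [folklore] -/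
theorem jacobiSym_natCast_eq_zero_iff {p : ℕ} (hp : p.Prime) (r : ℕ) :
    J((r : ℤ) | p) = 0 ↔ p ∣ r := by
  rw [jacobiSym.eq_zero_iff, Int.gcd_natCast_natCast]
  constructor
  · rintro ⟨-, h⟩
    rcases (Nat.dvd_prime hp).mp (Nat.gcd_dvd_right r p) with h4 | h4
    · exact absurd h4 h
    · rw [← h4]; exact Nat.gcd_dvd_left r p
  · intro h
    refine ⟨hp.ne_zero, ?_⟩
    rw [Nat.gcd_eq_right h]
    exact hp.one_lt.ne'

/-- **Legendre-equal residues differ by a `2m`-th power of a unit** when `gcd(p − 1, m) = 1` (`p` prime):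
if `p ∣ r` then `p ∣ r'` (take `u = 1`); otherwise `r'r` is a square `v²` (`quadraticChar_one_iff_isSquare`)
and `v/r = w^m` for a unit `w`, so `r' ≡ r · w^{2m}`. [folklore] -/
theorem exists_unit_pow_of_jacobiSym_eq {p : ℕ} (hp : p.Prime) {m : ℕ}
    (hm : Nat.Coprime (p - 1) m) {r r' : ℕ} (hJ : J((r : ℤ) | p) = J((r' : ℤ) | p)) :
    ∃ u : ℕ, ¬ p ∣ u ∧ r' ≡ r * u ^ (2 * m) [MOD p] := by
  haveI := Fact.mk hp
  by_cases hr : (p ∣ r)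
  · have hr' : p ∣ r' := (jacobiSym_natCast_eq_zero_iff hp r').mp
      (hJ ▸ (jacobiSym_natCast_eq_zero_iff hp r).mpr hr)
    refine ⟨1, fun h => hp.one_lt.ne' (Nat.eq_one_of_dvd_one h), ?_⟩
    rw [one_pow, mul_one]
    exact (Nat.modEq_zero_iff_dvd.mpr hr').trans (Nat.modEq_zero_iff_dvd.mpr hr).symm
  · have hr' : ¬ p ∣ r' := fun h =>
      hr ((jacobiSym_natCast_eq_zero_iff hp r).mp (hJ ▸ (jacobiSym_natCast_eq_zero_iff hp r').mpr h))
    have hr0 : (r : ZMod p) ≠ 0 := by rwa [Ne, ZMod.natCast_eq_zero_iff]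
    have hr'0 : (r' : ZMod p) ≠ 0 := by rwa [Ne, ZMod.natCast_eq_zero_iff]
    have e : ∀ n : ℕ, J((n : ℤ) | p) = quadraticChar (ZMod p) (n : ZMod p) := by
      intro n
      rw [← jacobiSym.legendreSym.to_jacobiSym, legendreSym, Int.cast_natCast]
    have hχ : quadraticChar (ZMod p) ((r' : ZMod p) * (r : ZMod p)) = 1 := by
      rw [map_mul, ← e, ← e, ← hJ, ← sq, e]
      exact quadraticChar_sq_one hr0
    obtain ⟨v, hv⟩ : IsSquare ((r' : ZMod p) * (r : ZMod p)) :=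
      (quadraticChar_one_iff_isSquare (mul_ne_zero hr'0 hr0)).mp hχ
    have hy0 : v * (r : ZMod p)⁻¹ ≠ 0 := by
      refine mul_ne_zero ?_ (inv_ne_zero hr0)
      rintro rfl
      rw [mul_zero] at hv
      exact (mul_ne_zero hr'0 hr0) hv
    obtain ⟨w, hw⟩ := units_pow_surjective hm (Units.mk0 _ hy0)
    have hwv : (w : ZMod p) ^ m = v * (r : ZMod p)⁻¹ := by
      have := congrArg (fun x : (ZMod p)ˣ => (x : ZMod p)) hw
      simpa using this
    refine ⟨(w : ZMod p).val, ?_, ?_⟩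
    · intro hdvd
      have : ((w : ZMod p).val : ZMod p) = 0 := by rw [ZMod.natCast_eq_zero_iff]; exact hdvd
      rw [ZMod.natCast_zmod_val] at this
      exact w.ne_zero this
    · rw [← ZMod.natCast_eq_natCast_iff]
      push_cast
      rw [ZMod.natCast_zmod_val, pow_mul', hwv]
      field_simp
      linear_combination hv

/-- **Core refutation, Kummer-local form.** For every balance `κ ≤ 2⁻²⁵`, every `ε < 2` and all
constants there is no family of integer tables in the crux's windows that is KUMMER-LOCAL at modulus `ℓⁿ`
(invariant under `r ↦ r·u^{2ℓⁿ} (mod p)` in each residue slot, `u` a unit, at every odd prime `p`) and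
whose sum over `p ∣ abc` is `≡ B (mod ℓⁿ)`, `|B| ≤ c₃`, on every `κ`-balanced abc-triple prime to `ℓ`.
Reduction to `tameLocal_quadraticLocal_false`: at odd `p` with `ℓ ∤ p − 1`, Kummer-local ⇒ quadratic-local
(`exists_unit_pow_of_jacobiSym_eq` with `m = ℓⁿ`). [folklore] -/
theorem tameLocal_kummerLocal_false (κ ε c₁ c₁' c₃ : ℝ) (hκ : κ ≤ 1 / 2 ^ 25) (hε : ε < 2)
    (hc₁ : 0 < c₁) (m₀ : ℕ)
    (H : ∀ ℓ n : ℕ, ℓ.Prime → 5 ≤ ℓ → m₀ ≤ ℓ ^ n →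
      ∃ t : ℕ → ℕ → ℕ → ℕ → ℕ → ℕ → ℕ → ℤ,
        (∀ p i j k r s z : ℕ, p.Prime →
          c₁ * (2 * ((i + j + k : ℕ) : ℝ) - 6 - ε) * Real.log p ≤ (t p i j k r s z : ℝ) ∧
          |(t p i j k r s z : ℝ)| ≤ c₁' * (((i + j + k : ℕ) : ℝ) + 1) * Real.log p) ∧
        (∀ p : ℕ, p.Prime → p ≠ 2 → ∀ i j k r s z r' s' z' u₁ u₂ u₃ : ℕ,
          ¬ p ∣ u₁ → ¬ p ∣ u₂ → ¬ p ∣ u₃ →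
          r' ≡ r * u₁ ^ (2 * ℓ ^ n) [MOD p] → s' ≡ s * u₂ ^ (2 * ℓ ^ n) [MOD p] →
          z' ≡ z * u₃ ^ (2 * ℓ ^ n) [MOD p] → t p i j k r s z = t p i j k r' s' z') ∧
        ∀ a b c : ℕ, IsABCTriple a b c → κ * (c : ℝ) ≤ (a : ℝ) → κ * (c : ℝ) ≤ (b : ℝ) →
          ¬ ℓ ∣ a * b * c → ∃ B : ℤ, |(B : ℝ)| ≤ c₃ ∧
            (∑ p ∈ (a * b * c).primeFactors, t p (a.factorization p) (b.factorization p)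
              (c.factorization p) (a / p ^ a.factorization p % p) (b / p ^ b.factorization p % p)
              (c / p ^ c.factorization p % p)) ≡ B [ZMOD ((ℓ ^ n : ℕ) : ℤ)]) :
    False := by
  refine tameLocal_quadraticLocal_false κ ε c₁ c₁' c₃ hκ hε hc₁ m₀ fun ℓ n hℓ h5 hm => ?_
  obtain ⟨t, hw, hKL, hT⟩ := H ℓ n hℓ h5 hm
  refine ⟨t, hw, fun p hp hp2 hℓp i j k r s z r' s' z' hr hs hz => ?_, hT⟩
  -- gcd(p - 1, ℓⁿ) = 1 since ℓ is prime and ℓ ∤ p - 1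
  have hcop : Nat.Coprime (p - 1) (ℓ ^ n) :=
    Nat.Coprime.pow_right n (Nat.coprime_comm.mp ((Nat.Prime.coprime_iff_not_dvd hℓ).mpr hℓp))
  obtain ⟨u₁, hu₁, h₁⟩ := exists_unit_pow_of_jacobiSym_eq hp hcop hr
  obtain ⟨u₂, hu₂, h₂⟩ := exists_unit_pow_of_jacobiSym_eq hp hcop hs
  obtain ⟨u₃, hu₃, h₃⟩ := exists_unit_pow_of_jacobiSym_eq hp hcop hz
  exact hKL p hp hp2 i j k r s z r' s' z' u₁ u₂ u₃ hu₁ hu₂ hu₃ h₁ h₂ h₃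

/-- **No Kummer-local tame-local receptacle** (the cleanest typed face of branch (i) of crux
`ReceptacleIdentity`, stmt-ABC-1813, through `TameLocalReceptacle`, stmt-ABC-14354): the crux's
statement with the table additionally KUMMER-LOCAL at modulus `ℓⁿ` — each unit residue is read only
through its class modulo `2ℓⁿ`-th powers, which is all that Kummer classes mod `ℓⁿ` and the quadratic
twist of the Frey–Tate curve can see — is FALSE, unconditionally, on the `2⁻²⁵`-balanced cell and for
every `ε < 2`. [folklore] -/
theorem not_tameLocalReceptacle_kummerLocal :
    ¬ (∀ κ : ℝ, 0 < κ → ∀ ε : ℝ, 0 < ε → ∃ c₁ c₁' c₃ : ℝ, 0 < c₁ ∧ ∃ m₀ : ℕ, ∀ ℓ n : ℕ, ℓ.Prime →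
      5 ≤ ℓ → m₀ ≤ ℓ ^ n → ∃ t : ℕ → ℕ → ℕ → ℕ → ℕ → ℕ → ℕ → ℤ,
        (∀ p i j k r s z : ℕ, p.Prime →
          c₁ * (2 * ((i + j + k : ℕ) : ℝ) - 6 - ε) * Real.log p ≤ (t p i j k r s z : ℝ) ∧
          |(t p i j k r s z : ℝ)| ≤ c₁' * (((i + j + k : ℕ) : ℝ) + 1) * Real.log p) ∧
        (∀ p : ℕ, p.Prime → p ≠ 2 → ∀ i j k r s z r' s' z' u₁ u₂ u₃ : ℕ,
          ¬ p ∣ u₁ → ¬ p ∣ u₂ → ¬ p ∣ u₃ →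
          r' ≡ r * u₁ ^ (2 * ℓ ^ n) [MOD p] → s' ≡ s * u₂ ^ (2 * ℓ ^ n) [MOD p] →
          z' ≡ z * u₃ ^ (2 * ℓ ^ n) [MOD p] → t p i j k r s z = t p i j k r' s' z') ∧
        ∀ a b c : ℕ, IsABCTriple a b c → κ * (c : ℝ) ≤ (a : ℝ) → κ * (c : ℝ) ≤ (b : ℝ) →
          ¬ ℓ ∣ a * b * c → ∃ B : ℤ, |(B : ℝ)| ≤ c₃ ∧
            (∑ p ∈ (a * b * c).primeFactors, t p (a.factorization p) (b.factorization p)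
              (c.factorization p) (a / p ^ a.factorization p % p) (b / p ^ b.factorization p % p)
              (c / p ^ c.factorization p % p)) ≡ B [ZMOD ((ℓ ^ n : ℕ) : ℤ)]) := by
  intro h
  obtain ⟨c₁, c₁', c₃, hc₁, m₀, H⟩ := h (1 / 2 ^ 25) (by positivity) 1 one_pos
  exact tameLocal_kummerLocal_false (1 / 2 ^ 25) 1 c₁ c₁' c₃ le_rfl (by norm_num) hc₁ m₀ H

end Summit.ABC.ABC.Theorems.TameLocalReceptacle
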